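import Literature.AnabelianGeometry.SemiGraphs.SurfaceTypeMixedBranchQuotients
import Literature.AnabelianGeometry.SemiGraphs.GluedObjectOfLocalData
import Literature.AnabelianGeometry.Anabelioids.FiberFunctorUnique

/-!
# Separating finite étale coverings of a surface-type semi-graph of anabelioids: the gluing

Mochizuki, *Semi-graphs of anabelioids*, Publ. RIMS **42** (2006), Example 2.10 p. 31 and Remark
2.10.1 p. 32: for `𝒢` of surface type, `C_{Π_𝒢}(Π_b) = Π_b`, "using exactly the same techniques as
those used in the proofs of Proposition 2.6, Corollary 2.7" — i.e. finite étale coverings of `𝒢`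
built by GLUING local coverings of the constituent anabelioids (Prop. 2.5 p. 27, Prop. 2.6 p. 28)
[cite: MochizukiSemiAnbd2006, Rem. 2.10.1 p.32].  The covering needed for the commensurator of an
EDGE group is one that is TRIVIAL over a prescribed set `E₁` of edges and RAMIFIED (of index exactly
`n`) over every other edge.  This proof-only file (cell abc-iut, layer L3, row F-1477, seat
abc-iut-L3-t12) performs the gluing: GIVEN at every vertex `v` an open normal `W_v ⊴ Π_v` of index
dividing `n ^ 3` killing the branch groups of the `E₁`-edges at `v` and meeting every other branch
group in exactly (the closure of) its `n`-th powers (supplied by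
`SurfaceTypeMixedBranchQuotients.lean` whenever the genus-`0` obstruction does not occur), the object
`A ∈ B(𝒢)` glued from "`n³/[Π_v : W_v]` copies of `Π_v/W_v`" (`GluedObjectOfLocalData.lean`) has
`Π_e` acting TRIVIALLY on `F_e(T_e)` for `e ∈ E₁` and NON-TRIVIALLY for `e ∉ E₁`
(`IsOfSurfaceType.exists_bObj_trivial_iff_mem`), for any family of edge basepoints; basepoint
transport of "acts trivially / non-trivially" (`smul_eq_self_of_iso`, `exists_smul_ne_of_iso`).
No statement here takes a side on any disputed claim; nothing about [IUTchIII] Cor. 3.12.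
-/

namespace Literature.AnabelianGeometry.SemiGraphs

open CategoryTheory CategoryTheory.PreGaloisCategory
open Literature.AnabelianGeometry.Anabelioids
open Topology

universe v₁ u₁ u

/-! ### Basepoint transport of "acts trivially" -/

section Transport

variable {C : Type u₁} [Category.{v₁} C]

/-- Along an isomorphism of basepoints `e : F ≅ F'`, `e_X(σ · x) = (e σ e⁻¹) · e_X(x)`. [folklore] -/
private theorem conjAut_smul_hom_app {F F' : C ⥤ FintypeCat.{v₁}} (e : F ≅ F') (X : C) (σ : Aut F)
    (x : F.obj X) : e.conjAut σ • e.hom.app X x = e.hom.app X (σ • x) := by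
  rw [mulAction_def, mulAction_def, Iso.conjAut_apply]
  change (e.inv ≫ σ.hom ≫ e.hom).app X (e.hom.app X x) = _
  simp only [NatTrans.comp_app, FintypeCat.comp_apply]
  rw [← FintypeCat.comp_apply (e.hom.app X) (e.inv.app X), ← NatTrans.comp_app, e.hom_inv_id,
    NatTrans.id_app, FintypeCat.id_apply]

/-- "`π₁` acts trivially on the fibre of `X`" does not depend on the basepoint.
[cite: MochizukiGeoAn2004, §1.1 p.10] -/
theorem smul_eq_self_of_iso {F F' : C ⥤ FintypeCat.{v₁}} (e : F ≅ F') (X : C)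
    (h : ∀ (σ : Aut F) (x : F.obj X), σ • x = x) (σ' : Aut F') (x' : F'.obj X) : σ' • x' = x' := by
  obtain ⟨σ, rfl⟩ := e.conjAut.surjective σ'
  have hx : e.hom.app X (e.inv.app X x') = x' := by
    rw [← FintypeCat.comp_apply (e.inv.app X) (e.hom.app X), ← NatTrans.comp_app, e.inv_hom_id,
      NatTrans.id_app, FintypeCat.id_apply]
  rw [← hx, conjAut_smul_hom_app, h]

/-- "`π₁` acts non-trivially on the fibre of `X`" does not depend on the basepoint.
[cite: MochizukiGeoAn2004, §1.1 p.10] -/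
theorem exists_smul_ne_of_iso {F F' : C ⥤ FintypeCat.{v₁}} (e : F ≅ F') (X : C)
    (h : ∃ (σ : Aut F) (x : F.obj X), σ • x ≠ x) : ∃ (σ' : Aut F') (x' : F'.obj X), σ' • x' ≠ x' := by
  obtain ⟨σ, x, hx⟩ := h
  refine ⟨e.conjAut σ, e.hom.app X x, fun h' => hx ?_⟩
  rw [conjAut_smul_hom_app] at h'
  exact ((FintypeCat.equivEquivIso.symm (e.app X)).injective h')

end Transport

namespace SemiGraphOfAnabelioids

variable {𝒢 : SemiGraphOfAnabelioids.{v₁, u₁, u}} {Sigma : Set ℕ}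

/-- **The separating object of `B(𝒢)` (gluing step).**  Let `𝒢` be of surface type, `E₁` a set of
edges, `n > 1` a `Σ`-integer, and suppose that at every vertex `v` (basepoint: the chosen fibre
functor of `𝒢_v`) there is an open normal `W_v ⊴ Π_v` of index dividing `n ^ 3` such that, for the
transports supplied with it, the branch group of every branch of an `E₁`-edge lies in `W_v` while
every other branch group meets `W_v` in exactly the closure of its `n`-th powers, properly.  Then
for every family of edge basepoints `F_e` there is an object `A = {S_v, T_e, ψ_b} ∈ B(𝒢)` such that
`Π_e = Aut F_e` acts TRIVIALLY on `F_e(T_e)` for every `e ∈ E₁` with an abutting branch and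
NON-TRIVIALLY for every `e ∉ E₁` with an abutting branch — the finite étale covering "trivial exactly
over `E₁`" glued as in [SemiAnbd] Prop. 2.6, p. 28. [cite: MochizukiSemiAnbd2006, Rem. 2.10.1 p.32] -/
theorem IsOfSurfaceType.exists_bObj_trivial_iff_mem (hS : 𝒢.IsOfSurfaceType Sigma)
    (E₁ : Set 𝒢.graph.Edge) {n : ℕ} (hn1 : 1 < n)
    (Fe : ∀ e : 𝒢.graph.Edge, 𝒢.E e ⥤ FintypeCat.{v₁}) [∀ e, FiberFunctor (Fe e)]
    (hgood : ∀ v : 𝒢.graph.Vertex,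
      ∃ W : Subgroup (Aut (GaloisCategory.getFiberFunctor (𝒢.V v))),
        IsOpen (W : Set (Aut (GaloisCategory.getFiberFunctor (𝒢.V v)))) ∧ W.Normal ∧
        W.index ∣ n ^ 3 ∧
        ∀ (b : 𝒢.graph.Star v) (Fe' : 𝒢.E (𝒢.graph.edgeOf b.1) ⥤ FintypeCat.{v₁}) [FiberFunctor Fe'],
          ∃ α : (𝒢.pull b.1 v b.2).pullback ⋙ Fe' ≅ GaloisCategory.getFiberFunctor (𝒢.V v),
            (b ∈ {b : 𝒢.graph.Star v | 𝒢.graph.edgeOf b.1 ∈ E₁} →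
              𝒢.branchSubgroup (GaloisCategory.getFiberFunctor (𝒢.V v)) b.1 b.2 Fe' α ≤ W) ∧
            (b ∉ {b : 𝒢.graph.Star v | 𝒢.graph.edgeOf b.1 ∈ E₁} →
              (W : Set (Aut (GaloisCategory.getFiberFunctor (𝒢.V v)))) ∩
                  (𝒢.branchSubgroup (GaloisCategory.getFiberFunctor (𝒢.V v)) b.1 b.2 Fe' α :
                    Set (Aut (GaloisCategory.getFiberFunctor (𝒢.V v)))) =
                closure ((fun x : Aut (GaloisCategory.getFiberFunctor (𝒢.V v)) => x ^ n) ''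
                  (𝒢.branchSubgroup (GaloisCategory.getFiberFunctor (𝒢.V v)) b.1 b.2 Fe' α :
                    Set (Aut (GaloisCategory.getFiberFunctor (𝒢.V v))))) ∧
              ¬ 𝒢.branchSubgroup (GaloisCategory.getFiberFunctor (𝒢.V v)) b.1 b.2 Fe' α ≤ W)) :
    ∃ A : 𝒢.BObj,
      (∀ (b : 𝒢.graph.Branch) (v : 𝒢.graph.Vertex), 𝒢.graph.abuts b = some v →
        𝒢.graph.edgeOf b ∈ E₁ →
        ∀ (σ : Aut (Fe (𝒢.graph.edgeOf b))) (y : (Fe (𝒢.graph.edgeOf b)).obj (A.T (𝒢.graph.edgeOf b))),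
          σ • y = y) ∧
      ∀ (b : 𝒢.graph.Branch) (v : 𝒢.graph.Vertex), 𝒢.graph.abuts b = some v →
        𝒢.graph.edgeOf b ∉ E₁ →
        ∃ (σ : Aut (Fe (𝒢.graph.edgeOf b))) (y : (Fe (𝒢.graph.edgeOf b)).obj (A.T (𝒢.graph.edgeOf b))),
          σ • y ≠ y := by
  classical
  let Fv : ∀ v : 𝒢.graph.Vertex, 𝒢.V v ⥤ FintypeCat.{v₁} := fun v =>
    GaloisCategory.getFiberFunctor (𝒢.V v)
  choose W hWo hWn hWidx hWb using hgood
  haveI : ∀ v, (W v).Normal := hWn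
  -- transports for the given edge basepoints, with the mixed property
  have hαex : ∀ (b : 𝒢.graph.Branch) (v : 𝒢.graph.Vertex) (h : 𝒢.graph.abuts b = some v),
      ∃ α : (𝒢.pull b v h).pullback ⋙ Fe (𝒢.graph.edgeOf b) ≅ Fv v,
        (𝒢.graph.edgeOf b ∈ E₁ → 𝒢.branchSubgroup (Fv v) b h (Fe _) α ≤ W v) ∧
        (𝒢.graph.edgeOf b ∉ E₁ →
          (W v : Set (Aut (Fv v))) ∩ (𝒢.branchSubgroup (Fv v) b h (Fe _) α : Set (Aut (Fv v))) =
            closure ((fun x => x ^ n) '' (𝒢.branchSubgroup (Fv v) b h (Fe _) α : Set (Aut (Fv v)))) ∧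
          ¬ 𝒢.branchSubgroup (Fv v) b h (Fe _) α ≤ W v) :=
    fun b v h => hWb v ⟨b, h⟩ (Fe (𝒢.graph.edgeOf b))
  choose α hαZ hαR using hαex
  -- the expected edge stabilisers: everything over `E₁`, the `n`-th powers elsewhere
  let K : ∀ e : 𝒢.graph.Edge, Set (Aut (Fe e)) := fun e =>
    if e ∈ E₁ then Set.univ else Set.range fun σ : Aut (Fe e) => σ ^ n
  have hK : ∀ (b : 𝒢.graph.Branch) (v : 𝒢.graph.Vertex) (h : 𝒢.graph.abuts b = some v),
      (((W v).comap ((Aut.autMulEquivOfIso (α b v h)).toMonoidHom.comp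
        (𝒢.piBToPiV b v h (Fe (𝒢.graph.edgeOf b))))) : Set (Aut (Fe (𝒢.graph.edgeOf b)))) =
        K (𝒢.graph.edgeOf b) := by
    intro b v h
    by_cases he : 𝒢.graph.edgeOf b ∈ E₁
    · simp only [K, if_pos he]
      rw [comap_branch_eq_top (Fv v) b h (Fe _) (α b v h) (W v) (hαZ b v h he), Subgroup.coe_top]
    · simp only [K, if_neg he]
      exact comap_branch_eq_range_pow hS.isOfInjectiveType (Fv v) b h (Fe _) (α b v h) (W v)
        (hαR b v h he).1
  have hD : 0 < n ^ 3 := pow_pos (by omega) 3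
  obtain ⟨A, -, hAe⟩ :=
    𝒢.exists_bObj_of_uniformLocalData Fv Fe α W hWo (n ^ 3) hD hWidx K hK
  refine ⟨A, fun b v h he σ y => ?_, fun b v h he => ?_⟩
  · -- over `E₁`: the stabiliser of every point is everything
    have hst := (hAe b v h).1 y
    simp only [K, if_pos he] at hst
    have : σ ∈ MulAction.stabilizer (Aut (Fe (𝒢.graph.edgeOf b))) y := by
      rw [← SetLike.mem_coe, hst]; exact Set.mem_univ σ
    exact this
  · -- off `E₁`: the fibre is nonempty and the stabilisers are the `n`-th powers, a proper subset
    have hcard := (hAe b v h).2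
    haveI : Nonempty ((Fe (𝒢.graph.edgeOf b)).obj (A.T (𝒢.graph.edgeOf b))) := by
      rw [← Finite.card_pos_iff, hcard]; exact hD
    obtain ⟨y⟩ := this
    have hst := (hAe b v h).1 y
    simp only [K, if_neg he] at hst
    -- some `σ ∈ Π_e` is not an `n`-th power: otherwise `Π_b ≤ W_v`
    have hex : ∃ σ : Aut (Fe (𝒢.graph.edgeOf b)), σ ∉ Set.range fun τ : Aut (Fe _) => τ ^ n := by
      by_contra hall
      push Not at hall
      apply (hαR b v h he).2
      intro x hx
      obtain ⟨σ, rfl⟩ := (𝒢.mem_branchSubgroup_iff (Fv v) b h (Fe _) (α b v h) x).mp hx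
      have hσ : σ ∈ ((W v).comap ((Aut.autMulEquivOfIso (α b v h)).toMonoidHom.comp
          (𝒢.piBToPiV b v h (Fe (𝒢.graph.edgeOf b)))) : Set (Aut (Fe (𝒢.graph.edgeOf b)))) := by
        rw [hK b v h]; simp only [K, if_neg he]; exact hall σ
      exact hσ
    obtain ⟨σ, hσ⟩ := hex
    refine ⟨σ, y, fun hy => hσ ?_⟩
    rw [← hst]
    exact hy

end SemiGraphOfAnabelioids

end Literature.AnabelianGeometry.SemiGraphs
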